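import Summits.NavierStokesRegularity.FluidComputer.GateBudgetPulseFree
import Summits.NavierStokesRegularity.FluidComputer.GateBudgetColdBracket
import HarnessLib

/-!
# What no tuning can beat, part 61: THE PULSE KEEPS THE CLOCK AMPLITUDE TO `243ε/K⁹` AND LEAVES
# A TRIGGER FLOOR `c(r)e^{-485K}` — law 2′ of the θ-drift audit (SPEC-INPUT-bp1 §AZ(6)/§BB(3)):
# over any stretch `[r, T']` of length `≤ 242/K⁹` of a headline member, entered at clock
# `b(r) ≥ 0` with trigger `c(r) ≤ ρ²/K⁹` and left at clock `b(T') ≤ 0` with trigger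
# `c(T') ≤ 2ρ²/K¹⁰`, the exit amplitude is `-b(T') ∈ [b(r) - 243ε/K⁹, b(r) + 243ε/K⁹]`
# (RELATIVE error `O(K⁻⁹)`, summable along the ladder — not part 55's absolute `10⁻⁵ε`), and the
# trigger cannot fall below `c(r)e^{-485K}` (the floor `L = 485K` that law 4″ = part 60 consumes)

Cell `pub-fluidc`, blueprint seat bp1 (gen 35, fourth item); same namespace and conventions as
parts 1–60 (`GateBudget*.lean`); imports part 55 (`GateBudgetPulseFree`: §165 `knob_pulse_free`;
through it part 53 `GateBudgetRadiusLipschitz`: §157 `radius_sqrt_lipschitz`, §158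
`knob_radius_kept_free`) and part 56 (`GateBudgetColdBracket`: §169 `exists_clock_action`,
`knob_trigger_memory`), hence part 1 (`c_nonneg`) and the Literature toolkit
(`Thm53.monotoneOn_sub_of_le_deriv`). Headline knob family `rotorCircuit K K¹⁰ ε ρ` from
(5.6) (`σ = ρ²e^{-K¹⁰}`, `μ = ε⁻¹K¹⁰`; modes `0 = a` carrier, `1 = b` clock, `2 = c` trigger,
`3 = d`, `4 = ã`). HONEST FRAMING (verbatim): low prior, high value-of-information experiment
on Tao's machine paradigm; NOT a claim that NS blows up. Nothing is proved about the
Navier–Stokes equations.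

## Why (SPEC-INPUT-bp1 §AZ(4), §BB(3): every iterated rung-law error must be relative)

The misfire ladder (20′d′) iterates a rung map `≍ 10⁻⁴K⁸` times. Part 55 §164/§165 type the
exit clock of a pulse as `b(T') ≤ -(θ₁ - 10⁻⁵)ε` from part 53 §158's kept radius
`|Δ(b² + c²)| ≤ ε²/10⁶` — an ABSOLUTE allowance, fine for the one-shot ring / exit-sign
hypotheses of part 52 §154 but not summable over the ladder (`10⁻⁵ × 10⁻⁴K⁸ ≫` the window
width `0.17`). The true loss is tiny and two-sided: by part 53 §157 the radius `√(b² + c²)` is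
`(ε + σ)`-Lipschitz at every time, so over a pulse of length `≤ 242/K⁹` it moves by at most
`(ε + σ)·242/K⁹`; at the entry `√(b² + c²) ∈ [b(r), b(r) + c(r)]` and at the exit
`√(b² + c²) ∈ [-b(T'), -b(T') + c(T')]` (both clocks signed, both triggers `≥ 0`), and the
triggers are `≤ ρ²/K⁹ ≤ 2ε/K¹⁹`. Likewise the trigger's memory law (part 56 §169,
`c(t) ≥ c(s)e^{μ(B(t) - B(s))}`, `B' = b`) with `|b| ≤ 2.001ε` on the pulse (kept radius) gives
`μ(B(T') - B(r)) ≥ -ε⁻¹K¹⁰·2.001ε·242/K⁹ ≥ -485K`.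

## What is proved

* §187 `pulse_clock_numerics`: `K ≥ 16`, `0 < ε`, `0 < ρ`, `K¹⁰ρ² ≤ 2ε` ⇒
  `(ε + ρ²e^{-K¹⁰})·(242/K⁹) + ρ²/K⁹ + 2ρ²/K¹⁰ ≤ 243ε/K⁹`, `ρ² ≤ ε`, and the dousing level of
  part 55 is `(1/K¹⁰ + 4e^{-K¹⁰}/K¹⁰)ρ² ≤ 2ρ²/K¹⁰`.
* §188 `knob_pulse_clock_kept` (LAW 2′): headline member from `delayInit`, `K ≥ 16`, `0 < ε`,
  `0 < ρ`, `K¹⁰ρ² ≤ 2ε`; any `0 ≤ r ≤ T'` with `T' - r ≤ 242/K⁹`, `b(r) ≥ 0`, `c(r) ≤ ρ²/K⁹`,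
  `b(T') ≤ 0`, `c(T') ≤ 2ρ²/K¹⁰` ⇒ `b(r) - 243ε/K⁹ ≤ -b(T') ≤ b(r) + 243ε/K⁹`.
* §189 `knob_pulse_trigger_floor`: headline member, `K ≥ 16`, `0 < ε`, `ρ² ≤ ε`; any
  `0 ≤ r ≤ T'` with `T' - r ≤ 242/K⁹`, entry radius `b(r)² + c(r)² ≤ 4ε²`, `c(r) > 0` ⇒
  `c(r)e^{-485K} ≤ c(T')`.
* §190 `knob_pulse_exit` (the pulse half of a rung, packaged for law 4″): on the window
  `200ε/K²⁰ ≤ ρ²`, `K¹⁰ρ² ≤ 2ε`, from an ignition `r ≥ 0` with `b(r) = θ₁ε`, `5/4 ≤ θ₁ ≤ 3/2`,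
  `c(r) = ρ²/K⁹`: part 55 §165's dousing time `T'` exists with `r < T'`, `T' - r ≤ 242/K⁹`,
  `c > 0` on `[r, T']`, `c(T') ≤ (1/K¹⁰ + 4e^{-K¹⁰}/K¹⁰)ρ² ≤ 2ρ²/K¹⁰`,
  `(ρ²/K⁹)e^{-485K} ≤ c(T')`, the exit clock `b(T') = -θ'ε` with
  `θ₁ - 243/K⁹ ≤ θ' ≤ θ₁ + 243/K⁹`, the kept radius `|Δ(b² + c²)| ≤ ε²/10⁶` on `[r, T']` and
  the output growth `ã(T') ≤ ã(r) + K(T' - r)` (part 55's facts, re-exported for part 52 §154).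

HONEST LIMITS. (i) `243/K⁹` is crude (`242(1 + 2/K¹⁰) + 6/K¹⁰` would do) but relative, which
is all the ledger needs; (ii) `485K` in the floor costs law 4″ an overshoot `485/(K⁹θ)` of the
relight time, same order as its own slack; (iii) headline family `M = K¹⁰`, `K ≥ 16` only;
(iv) nothing about Navier–Stokes.
[cite: Tao2016AveragedNS, §5.5 Theorem 5.3, (5.5), (5.6), (b-eq), (c-eq), (energy-con)]
-/

noncomputable section

namespace Summit.NavierStokesRegularity.FluidComputer.GateBudget

open Real Set
open Literature.Analysis.FluidPDE.Tao2016AveragedNS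

variable {K ε ρ : ℝ} {X : ℝ → Fin 5 → ℝ}

/-! ## §187 Numerics -/

/-- §187 NUMERICS of the pulse clock law: `K ≥ 16`, `0 < ε`, `0 < ρ`, `K¹⁰ρ² ≤ 2ε` ⇒
`(ε + ρ²e^{-K¹⁰})(242/K⁹) + ρ²/K⁹ + 2ρ²/K¹⁰ ≤ 243ε/K⁹`, `ρ² ≤ ε`, and
`(1/K¹⁰ + 4e^{-K¹⁰}/K¹⁰)ρ² ≤ 2ρ²/K¹⁰`. [derived: this file §187] -/
theorem pulse_clock_numerics (hK : 16 ≤ K) (hε : 0 < ε) (hρ : 0 < ρ)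
    (hhi : K ^ 10 * ρ ^ 2 ≤ 2 * ε) :
    (ε + ρ ^ 2 * exp (-K ^ 10)) * (242 / K ^ 9) + ρ ^ 2 / K ^ 9 + 2 * ρ ^ 2 / K ^ 10
        ≤ 243 * ε / K ^ 9 ∧ ρ ^ 2 ≤ ε ∧
      (1 / K ^ 10 + 4 * exp (-K ^ 10) / K ^ 10) * ρ ^ 2 ≤ 2 * ρ ^ 2 / K ^ 10 := by
  have hK0 : (0 : ℝ) < K := by linarith
  have hK9 : (0 : ℝ) < K ^ 9 := by positivity
  have hK10 : (2 : ℝ) ^ 40 ≤ K ^ 10 := by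
    calc (2 : ℝ) ^ 40 = 16 ^ 10 := by norm_num
      _ ≤ K ^ 10 := pow_le_pow_left₀ (by norm_num) hK 10
  have he1 : exp (-K ^ 10) ≤ 1 := Real.exp_le_one_iff.2 (by
    have : (0 : ℝ) ≤ K ^ 10 := by positivity
    linarith)
  have hσ1 : ρ ^ 2 * exp (-K ^ 10) ≤ ρ ^ 2 := mul_le_of_le_one_right (sq_nonneg ρ) he1
  have hρK : ρ ^ 2 * 2 ^ 40 ≤ ρ ^ 2 * K ^ 10 := mul_le_mul_of_nonneg_left hK10 (sq_nonneg ρ)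
  have hρε : 490 * ρ ^ 2 ≤ ε := by nlinarith only [hρK, hhi]
  have h2K : 2 * ρ ^ 2 / K ≤ ρ ^ 2 := by
    rw [div_le_iff₀ hK0]; nlinarith only [sq_nonneg ρ, hK]
  refine ⟨?_, by linarith only [hρε, sq_nonneg ρ], ?_⟩
  · have key : (ε + ρ ^ 2 * exp (-K ^ 10)) * 242 + ρ ^ 2 + 2 * ρ ^ 2 / K ≤ 243 * ε := by
      linarith only [hσ1, h2K, hρε, sq_nonneg ρ]
    have e : (ε + ρ ^ 2 * exp (-K ^ 10)) * (242 / K ^ 9) + ρ ^ 2 / K ^ 9 + 2 * ρ ^ 2 / K ^ 10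
        = ((ε + ρ ^ 2 * exp (-K ^ 10)) * 242 + ρ ^ 2 + 2 * ρ ^ 2 / K) / K ^ 9 := by
      field_simp
    rw [e, div_le_div_iff_of_pos_right hK9]
    exact key
  · have hK10' : (0 : ℝ) < K ^ 10 := by positivity
    have e4 : 4 * exp (-K ^ 10) ≤ 1 := by
      have hx : (3 : ℝ) ≤ K ^ 10 := le_trans (by norm_num) hK10
      have h := Real.add_one_le_exp (K ^ 10)
      have hpos : 0 < exp (K ^ 10) := exp_pos _
      have h4 : ((1 : ℝ) / 4)⁻¹ = 4 := by norm_num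
      have hinv : (exp (K ^ 10))⁻¹ ≤ 1 / 4 := by
        rw [inv_le_comm₀ hpos (by norm_num), h4]
        linarith only [h, hx]
      rw [Real.exp_neg]
      linarith only [hinv]
    have : (1 / K ^ 10 + 4 * exp (-K ^ 10) / K ^ 10) * ρ ^ 2
        = (1 + 4 * exp (-K ^ 10)) * ρ ^ 2 / K ^ 10 := by
      field_simp
    rw [this, div_le_div_iff_of_pos_right hK10']
    nlinarith only [e4, sq_nonneg ρ]

/-! ## §188 Law 2′: the pulse keeps the clock amplitude -/

/-- §188 **LAW 2′ — THE PULSE KEEPS THE CLOCK AMPLITUDE TO `243ε/K⁹`.** Headline member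
`rotorCircuit K K¹⁰ ε ρ` from (5.6), `K ≥ 16`, `0 < ε`, `0 < ρ`, `K¹⁰ρ² ≤ 2ε`; any `0 ≤ r ≤ T'`
with `T' - r ≤ 242/K⁹`, entered at clock `b(r) ≥ 0` and trigger `c(r) ≤ ρ²/K⁹`, left at clock
`b(T') ≤ 0` and trigger `c(T') ≤ 2ρ²/K¹⁰`. THEN `b(r) - 243ε/K⁹ ≤ -b(T') ≤ b(r) + 243ε/K⁹`
(part 53 §157's Lipschitz law for `√(b² + c²)`, read at both ends).
[cite: Tao2016AveragedNS, §5.5 (5.5), (5.6), (b-eq), (c-eq)] -/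
theorem knob_pulse_clock_kept
    (hX : ∀ t, HasDerivAt X (RotorKnob.rotorCircuit K (K ^ 10) ε ρ (X t)) t)
    (h0 : X 0 = delayInit) (hK : 16 ≤ K) (hε : 0 < ε) (hρ : 0 < ρ)
    (hhi : K ^ 10 * ρ ^ 2 ≤ 2 * ε) {r T' : ℝ} (hr : 0 ≤ r) (hrT : r ≤ T')
    (hT' : T' - r ≤ 242 / K ^ 9) (hbr : 0 ≤ X r 1) (hcr : X r 2 ≤ ρ ^ 2 / K ^ 9)
    (hbT : X T' 1 ≤ 0) (hcT : X T' 2 ≤ 2 * ρ ^ 2 / K ^ 10) :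
    X r 1 - 243 * ε / K ^ 9 ≤ -X T' 1 ∧ -X T' 1 ≤ X r 1 + 243 * ε / K ^ 9 := by
  have hK0 : (0 : ℝ) < K := by linarith
  obtain ⟨hN, -, -⟩ := pulse_clock_numerics hK hε hρ hhi
  have hXf := hX
  rw [RotorKnob.rotorCircuit_eq_fiveGate] at hXf
  have hσ : (0 : ℝ) ≤ ρ ^ 2 * exp (-K ^ 10) := by positivity
  obtain ⟨hup, hdn⟩ := radius_sqrt_lipschitz hXf h0 hε.le hσ hr (right_mem_Icc.2 hrT)
  have hcr0 : 0 ≤ X r 2 := c_nonneg hXf h0 hσ hr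
  have hcT0 : 0 ≤ X T' 2 := c_nonneg hXf h0 hσ (hr.trans hrT)
  have hlip : (ε + ρ ^ 2 * exp (-K ^ 10)) * (T' - r)
      ≤ (ε + ρ ^ 2 * exp (-K ^ 10)) * (242 / K ^ 9) :=
    mul_le_mul_of_nonneg_left hT' (by positivity)
  have hRr : √(X r 1 ^ 2 + X r 2 ^ 2) ≤ X r 1 + X r 2 :=
    Real.sqrt_le_iff.2 ⟨by positivity, by nlinarith only [mul_nonneg hbr hcr0]⟩
  have hbRr : X r 1 ≤ √(X r 1 ^ 2 + X r 2 ^ 2) :=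
    Real.le_sqrt_of_sq_le (by nlinarith only [sq_nonneg (X r 2)])
  have hRT : √(X T' 1 ^ 2 + X T' 2 ^ 2) ≤ -X T' 1 + X T' 2 :=
    Real.sqrt_le_iff.2 ⟨by linarith, by nlinarith only [mul_nonneg (neg_nonneg.2 hbT) hcT0]⟩
  have hbRT : -X T' 1 ≤ √(X T' 1 ^ 2 + X T' 2 ^ 2) :=
    Real.le_sqrt_of_sq_le (by nlinarith only [sq_nonneg (X T' 2)])
  have h9 : (0 : ℝ) ≤ ρ ^ 2 / K ^ 9 := by positivity
  have h10 : (0 : ℝ) ≤ 2 * ρ ^ 2 / K ^ 10 := by positivity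
  constructor
  · linarith only [hbRr, hdn, hlip, hRT, hcT, hN, h9]
  · linarith only [hbRT, hup, hlip, hRr, hcr, hN, h10]

/-! ## §189 The trigger floor left by a pulse -/

/-- §189 **THE TRIGGER FLOOR LEFT BY A PULSE.** Headline member from (5.6), `K ≥ 16`, `0 < ε`,
`ρ² ≤ ε`; any `0 ≤ r ≤ T'` with `T' - r ≤ 242/K⁹`, entry radius `b(r)² + c(r)² ≤ 4ε²` and
`c(r) > 0`. THEN `c(r)e^{-485K} ≤ c(T')`: the radius is kept (part 53 §158), so `b ≥ -2.001ε`
on `[r, T']`, the clock action falls by at most `2.001ε·242/K⁹`, and part 56 §169's memory law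
`c(T') ≥ c(r)e^{ε⁻¹K¹⁰(B(T') - B(r))}` gives the floor.
[cite: Tao2016AveragedNS, §5.5 (5.5), (5.6), (b-eq), (c-eq)] -/
theorem knob_pulse_trigger_floor
    (hX : ∀ t, HasDerivAt X (RotorKnob.rotorCircuit K (K ^ 10) ε ρ (X t)) t)
    (h0 : X 0 = delayInit) (hK : 16 ≤ K) (hε : 0 < ε) (hρε : ρ ^ 2 ≤ ε) {r T' : ℝ}
    (hr : 0 ≤ r) (hrT : r ≤ T') (hT' : T' - r ≤ 242 / K ^ 9)
    (hRr : X r 1 ^ 2 + X r 2 ^ 2 ≤ 4 * ε ^ 2) (hcr : 0 < X r 2) :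
    X r 2 * exp (-(485 * K)) ≤ X T' 2 := by
  have hK0 : (0 : ℝ) < K := by linarith
  have hK10 : (0 : ℝ) ≤ K ^ 10 := by positivity
  have hXf := hX
  rw [RotorKnob.rotorCircuit_eq_fiveGate] at hXf
  obtain ⟨B, hB⟩ := exists_clock_action hXf
  have hkept := knob_radius_kept_free hX h0 hK10 hε hρε hK hr hT' hRr
  -- the clock is `≥ -2.001ε` on the pulse
  have hblow : ∀ t ∈ Icc r T', -(2001 / 1000 * ε) ≤ X t 1 := by
    intro t ht
    have h := (abs_le.1 (hkept t ht)).2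
    have hb2 : X t 1 ^ 2 ≤ (2001 / 1000 * ε) ^ 2 := by
      nlinarith only [h, hRr, sq_nonneg (X t 2), hε]
    exact (abs_le_of_sq_le_sq' hb2 (by positivity)).1
  -- hence the action falls by at most `2.001ε(T' - r)`
  have hΦ : ∀ t : ℝ, HasDerivAt (fun t => -(2001 / 1000 * ε) * t) (-(2001 / 1000 * ε)) t :=
    fun t => by simpa using (hasDerivAt_id t).const_mul (-(2001 / 1000 * ε))
  have hm := Thm53.monotoneOn_sub_of_le_deriv (convex_Icc r T') (fun t _ => hB t)
    (fun t _ => hΦ t) hblow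
  have hBr := hm (left_mem_Icc.2 hrT) (right_mem_Icc.2 hrT) hrT
  have hBd : -(2001 / 1000 * ε * (242 / K ^ 9)) ≤ B T' - B r := by
    have : 2001 / 1000 * ε * (T' - r) ≤ 2001 / 1000 * ε * (242 / K ^ 9) :=
      mul_le_mul_of_nonneg_left hT' (by positivity)
    simp only at hBr
    linarith only [hBr, this]
  have hexp : -(485 * K) ≤ ε⁻¹ * K ^ 10 * (B T' - B r) := by
    have h1 : ε⁻¹ * K ^ 10 * (-(2001 / 1000 * ε * (242 / K ^ 9)))
        ≤ ε⁻¹ * K ^ 10 * (B T' - B r) := mul_le_mul_of_nonneg_left hBd (by positivity)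
    have h2 : ε⁻¹ * K ^ 10 * (-(2001 / 1000 * ε * (242 / K ^ 9))) = -(484242 / 1000 * K) := by
      field_simp
      ring
    rw [h2] at h1
    nlinarith only [h1, hK0]
  have hmem := knob_trigger_memory hX h0 hε hK10 hB hr hrT hcr
  calc X r 2 * exp (-(485 * K)) ≤ X r 2 * exp (ε⁻¹ * K ^ 10 * (B T' - B r)) :=
        mul_le_mul_of_nonneg_left (Real.exp_le_exp.2 hexp) hcr.le
    _ ≤ X T' 2 := hmem

/-! ## §190 The pulse half of a rung, packaged -/

/-- §190 **THE PULSE HALF OF A RUNG.** Headline member from (5.6) on the window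
`200ε/K²⁰ ≤ ρ²`, `K¹⁰ρ² ≤ 2ε` (`K ≥ 16`, `0 < ε`, `0 < ρ`); an ignition time `r ≥ 0` with
`b(r) = θ₁ε`, `5/4 ≤ θ₁ ≤ 3/2`, `c(r) = ρ²/K⁹`. THEN part 55 §165's dousing time `T'` exists:
`r < T'`, `T' - r ≤ 242/K⁹`, `c > 0` on `[r, T']`, `c(T') ≤ (1/K¹⁰ + 4e^{-K¹⁰}/K¹⁰)ρ² ≤ 2ρ²/K¹⁰`,
the floor `(ρ²/K⁹)e^{-485K} ≤ c(T')`, the exit clock `b(T') = -θ'ε` with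
`θ₁ - 243/K⁹ ≤ θ' ≤ θ₁ + 243/K⁹` (§188), the kept radius on `[r, T']` and the output growth
`ã(T') ≤ ã(r) + K(T' - r)` — the entry facts of law 4″ (part 60 `knob_relight`, `L = 485K`)
and of part 52 §153/§154. [cite: Tao2016AveragedNS, §5.5 Theorem 5.3, (5.5), (5.6)] -/
theorem knob_pulse_exit
    (hX : ∀ t, HasDerivAt X (RotorKnob.rotorCircuit K (K ^ 10) ε ρ (X t)) t)
    (h0 : X 0 = delayInit) (hK : 16 ≤ K) (hε : 0 < ε) (hρ : 0 < ρ)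
    (hlo : 200 * ε / K ^ 20 ≤ ρ ^ 2) (hhi : K ^ 10 * ρ ^ 2 ≤ 2 * ε) {r θ₁ : ℝ} (hr : 0 ≤ r)
    (hθ₁ : 5 / 4 ≤ θ₁) (hθ₁' : θ₁ ≤ 3 / 2) (hbr : X r 1 = θ₁ * ε)
    (hcr : X r 2 = ρ ^ 2 / K ^ 9) :
    ∃ T' θ' : ℝ, r < T' ∧ T' - r ≤ 242 / K ^ 9 ∧ (∀ t ∈ Icc r T', 0 < X t 2) ∧
      X T' 2 ≤ (1 / K ^ 10 + 4 * exp (-K ^ 10) / K ^ 10) * ρ ^ 2 ∧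
      X T' 2 ≤ 2 * ρ ^ 2 / K ^ 10 ∧ ρ ^ 2 / K ^ 9 * exp (-(485 * K)) ≤ X T' 2 ∧
      X T' 1 = -(θ' * ε) ∧ θ₁ - 243 / K ^ 9 ≤ θ' ∧ θ' ≤ θ₁ + 243 / K ^ 9 ∧
      (∀ t ∈ Icc r T', |X t 1 ^ 2 + X t 2 ^ 2 - (X r 1 ^ 2 + X r 2 ^ 2)| ≤ ε ^ 2 / 10 ^ 6) ∧
      X T' 4 ≤ X r 4 + K * (T' - r) := by
  have hK0 : (0 : ℝ) < K := by linarith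
  have hK1 : (1 : ℝ) ≤ K := by linarith
  obtain ⟨hN, hρε, hlam⟩ := pulse_clock_numerics hK hε hρ hhi
  have hRr : X r 1 ^ 2 + X r 2 ^ 2 ≤ 4 * ε ^ 2 := by
    rw [hbr, hcr]
    have h1 : (θ₁ * ε) ^ 2 ≤ (3 / 2 * ε) ^ 2 :=
      pow_le_pow_left₀ (by positivity) (by nlinarith only [hθ₁', hε]) 2
    have h2 : ρ ^ 2 / K ^ 9 ≤ ε := by
      calc ρ ^ 2 / K ^ 9 ≤ ρ ^ 2 := div_le_self (sq_nonneg ρ) (one_le_pow₀ hK1)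
        _ ≤ ε := hρε
    have h3 : (ρ ^ 2 / K ^ 9) ^ 2 ≤ ε ^ 2 := pow_le_pow_left₀ (by positivity) h2 2
    nlinarith only [h1, h3, hε]
  have hbr' : θ₁ * ε ≤ X r 1 := hbr.ge
  have hcr' : ρ ^ 2 / K ^ 10 ≤ X r 2 := by
    rw [hcr]
    exact div_le_div_of_nonneg_left (sq_nonneg ρ) (by positivity)
      (pow_le_pow_right₀ hK1 (by norm_num))
  obtain ⟨T', hrT, hτ, -, hpos, hcT, hbT, -, hkept, hgrow⟩ :=
    knob_pulse_free hX h0 hK hε hρ hlo hhi hr hθ₁ hbr' hcr' hRr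
  have hcT2 : X T' 2 ≤ 2 * ρ ^ 2 / K ^ 10 := hcT.trans hlam
  have hbT0 : X T' 1 ≤ 0 := by
    have : 0 ≤ (θ₁ - 1 / 10 ^ 5) * ε := by nlinarith only [hθ₁, hε]
    linarith only [hbT, this]
  have hb0 : 0 ≤ X r 1 := by rw [hbr]; positivity
  obtain ⟨hlow, hupp⟩ := knob_pulse_clock_kept hX h0 hK hε hρ hhi hr hrT.le hτ hb0 hcr.le
    hbT0 hcT2
  have hfl := knob_pulse_trigger_floor hX h0 hK hε hρε hr hrT.le hτ hRr (by rw [hcr]; positivity)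
  rw [hcr] at hfl
  refine ⟨T', -X T' 1 / ε, hrT, hτ, hpos, hcT, hcT2, hfl, ?_, ?_, ?_, hkept, hgrow⟩
  · field_simp
  · rw [le_div_iff₀ hε]
    have : (θ₁ - 243 / K ^ 9) * ε = θ₁ * ε - 243 * ε / K ^ 9 := by ring
    rw [this, ← hbr]
    exact hlow
  · rw [div_le_iff₀ hε]
    have : (θ₁ + 243 / K ^ 9) * ε = θ₁ * ε + 243 * ε / K ^ 9 := by ring
    rw [this, ← hbr]
    exact hupp

end Summit.NavierStokesRegularity.FluidComputer.GateBudget
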